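/-
Origin: expansion seat `planner-pub-hodgecm-pv14-g6-0`, handover import Pv14g6.SchwartzInvolFlowTransport -> import HodgeCM.Automorphic.SchwartzInvolFlowTransport; import Pv14g6.SchwartzExpFlow -> import HodgeCM.Automorphic.SchwartzExpFlow (Mathlib.Analysis.Calculus.MeanValue untouched) ; after t31 rows 12 and 13 (`HOME/pub-hodgecm-pv14-g6/lean/Pv14g6/SchwartzExpFlowInvol.lean`, md5 064c1fe5, 105 lines);
landed by the gen-8 packager in gate run 31 as `HodgeCM/Automorphic/SchwartzExpFlowInvol.lean` (import ^import Pv14g6\.SchwartzInvolFlowTransport[ \t]*$→import HodgeCM.Automorphic.SchwartzInvolFlowTransport ×1; import ^import Pv14g6\.SchwartzExpFlow[ \t]*$→import HodgeCM.Automorphic.SchwartzExpFlow ×1).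
-/
/-
Copyright: HodgeCM public adjudication package, seat pub-hodgecm-pv14-g6 (DAG-NODE PROVER #14, gen 6).
File #30 of this seat.  Kernel-checked, no new axioms.  Imports files #27, #28 of this seat and Mathlib.
-/
import Summits.HodgeConjecture.HodgeCM.Automorphic.SchwartzInvolFlowTransport
import Summits.HodgeConjecture.HodgeCM.Automorphic.SchwartzExpFlow
import Mathlib.Analysis.Calculus.MeanValue

/-!
# `exp(sJ) = cosh s · 1 + sinh s · J` for `J² = 1`: the involutive flow IS the exponential flow

Files #25/#27 use the closed form `involFlow J hJ s = cosh s · 1 + sinh s · J`; file #28 uses Mathlib's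
operator exponential `expFlow J s = exp(sJ)`.  For an involutive generator they coincide:

* `hasDerivAt_coshSinhCLM : d/ds (cosh s · 1 + sinh s · J) = J (cosh s · 1 + sinh s · J)` (`J² = 1`);
* `expCLM_eq_coshSinhCLM : exp(sJ) = cosh s · 1 + sinh s · J` — by the derivative argument
  `d/ds [exp(sJ) (cosh s · 1 - sinh s · J)] = 0` (no power series are rearranged);
* **`expFlow_eq_involFlow : expFlow J = involFlow J hJ`** as families of continuous linear
  equivalences, so every statement of files #25–#27 about `involFlow` is a statement about `exp(sJ)`
  and conversely (`tendsto_compCLM_expFlow_sub_div_ofReal` ↔ `tendsto_compCLM_involFlow_sub_div_ofReal`).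

Only published mathematics is used (Mathlib); nothing here refers to the objects under adjudication.
-/

noncomputable section

open Filter Topology
open scoped SchwartzMap ContDiff

namespace HodgeCM
namespace SchwartzWeil

section ExpInvol

variable {E : Type*} [NormedAddCommGroup E] [NormedSpace ℝ E] (J : E →L[ℝ] E) (hJ : J * J = 1)
include hJ

/-- `d/ds (cosh s · 1 + sinh s · J) = J · (cosh s · 1 + sinh s · J)` when `J² = 1`. -/
theorem hasDerivAt_coshSinhCLM (s₀ : ℝ) :
    HasDerivAt (coshSinhCLM J) (J * coshSinhCLM J s₀) s₀ := by
  have h := ((Real.hasDerivAt_cosh s₀).smul_const (1 : E →L[ℝ] E)).add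
    ((Real.hasDerivAt_sinh s₀).smul_const J)
  have e : Real.sinh s₀ • (1 : E →L[ℝ] E) + Real.cosh s₀ • J = J * coshSinhCLM J s₀ := by
    simp only [coshSinhCLM, mul_add, mul_smul_comm, mul_one, hJ]
    abel
  rw [← e]
  exact h

/-- `d/ds (cosh s · 1 - sinh s · J) = -J · (cosh s · 1 - sinh s · J)`, i.e. the derivative of
`s ↦ coshSinhCLM J (-s)`. -/
theorem hasDerivAt_coshSinhCLM_neg (s₀ : ℝ) :
    HasDerivAt (fun s => coshSinhCLM J (-s)) (-(J * coshSinhCLM J (-s₀))) s₀ := by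
  have h := ((Real.hasDerivAt_cosh s₀).smul_const (1 : E →L[ℝ] E)).sub
    ((Real.hasDerivAt_sinh s₀).smul_const J)
  have e : Real.sinh s₀ • (1 : E →L[ℝ] E) - Real.cosh s₀ • J = -(J * coshSinhCLM J (-s₀)) := by
    simp only [coshSinhCLM, Real.cosh_neg, Real.sinh_neg, mul_add, mul_smul_comm, mul_one, hJ, neg_smul,
      mul_neg, neg_add, neg_neg]
    abel
  rw [← e]
  refine h.congr_of_eventuallyEq (Eventually.of_forall fun s => ?_)
  show coshSinhCLM J (-s) = Real.cosh s • (1 : E →L[ℝ] E) - Real.sinh s • J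
  rw [coshSinhCLM, Real.cosh_neg, Real.sinh_neg, neg_smul, sub_eq_add_neg]

variable [CompleteSpace E]

/-- The conserved quantity: `exp(sJ) · (cosh s · 1 - sinh s · J) = 1` for all `s`. -/
theorem expCLM_mul_coshSinhCLM_neg (s : ℝ) : expCLM J s * coshSinhCLM J (-s) = 1 := by
  have hd : ∀ t : ℝ, HasDerivAt (fun t => expCLM J t * coshSinhCLM J (-t)) 0 t := by
    intro t
    have h1 : HasDerivAt (fun t : ℝ => expCLM J t) (J * NormedSpace.exp (t • J)) t :=
      hasDerivAt_exp_smul_const' J t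
    have h := h1.mul (hasDerivAt_coshSinhCLM_neg J hJ t)
    have hc : J * NormedSpace.exp (t • J) = NormedSpace.exp (t • J) * J :=
      (((Commute.refl J).smul_right t).exp_right).eq
    have e : J * NormedSpace.exp (t • J) * coshSinhCLM J (-t)
        + expCLM J t * -(J * coshSinhCLM J (-t)) = 0 := by
      rw [hc, expCLM_def, mul_neg, mul_assoc, add_neg_cancel]
    rw [← e]
    exact h
  have hconst := is_const_of_deriv_eq_zero (fun t => (hd t).differentiableAt) (fun t => (hd t).deriv)
  rw [hconst s 0, expCLM_zero, neg_zero, coshSinhCLM_zero, one_mul]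

/-- **`exp(sJ) = cosh s · 1 + sinh s · J`** for an involutive generator. -/
theorem expCLM_eq_coshSinhCLM (s : ℝ) : expCLM J s = coshSinhCLM J s := by
  calc expCLM J s = expCLM J s * (coshSinhCLM J (-s) * coshSinhCLM J s) := by
        rw [← coshSinhCLM_add J hJ, neg_add_cancel, coshSinhCLM_zero, mul_one]
    _ = coshSinhCLM J s := by rw [← mul_assoc, expCLM_mul_coshSinhCLM_neg J hJ, one_mul]

/-- (Ported verbatim from the HodgeCMPerL package; no docstring in the source.) -/
theorem exp_smul_eq_coshSinhCLM (s : ℝ) :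
    NormedSpace.exp (s • J) = Real.cosh s • (1 : E →L[ℝ] E) + Real.sinh s • J :=
  expCLM_eq_coshSinhCLM J hJ s

/-- **The exponential flow of an involutive generator is the involutive flow**:
`expFlow J = involFlow J hJ` as families of continuous linear equivalences. -/
theorem expFlow_eq_involFlow : expFlow J = involFlow J hJ :=
  eq_involFlow_of_coe_eq hJ fun s => by rw [coe_expFlow, exp_smul_eq_coshSinhCLM J hJ]

/-- (Ported verbatim from the HodgeCMPerL package; no docstring in the source.) -/
theorem expFlow_apply_eq_involFlow_apply (s : ℝ) (x : E) :
    expFlow J s x = Real.cosh s • x + Real.sinh s • J x := by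
  rw [expFlow_eq_involFlow J hJ, involFlow_apply]

end ExpInvol

end SchwartzWeil
end HodgeCM
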